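import Mathlib
import Summits.RiemannHypothesis.RiemannHypothesis.Theorems.DeBrangesSuzukiDoorLaplaceWindow

/-!
# v6 «SuzukiWindowsDoorConverse» — L4: Fubini for the window operator against a character

RH-FREE, ζ-FREE real analysis.  For a continuous kernel `K` with `x ↦ K(x)e^{izx}` integrable on `ℝ` and
`∫ K(x)e^{izx}dx = Θz` (`Im z > 0`), and `f ∈ L²(−t,t)`, the function `g(x) = ∫_{(−t,t)} K(x+y)f(y)dy` satisfies
`∫_ℝ g(x)e^{izx}dx = Θz · ∫_{(−t,t)} f(y)e^{−izy}dy`, with `x ↦ g(x)e^{izx}` integrable; and `g` is continuous.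
Nothing here bears on the truth of RH.
-/

set_option linter.dupNamespace false

open MeasureTheory Set Filter Complex Topology

namespace Summit.RiemannHypothesis.RiemannHypothesis.Theorems.SuzukiWindowsDoorConverse

/-- `L²` on a window is inside `L¹`. -/
lemma integrable_of_memLp_window {t : ℝ} {f : ℝ → ℝ} (hf : MemLp f 2 (volume.restrict (Ioo (-t) t))) :
    Integrable f (volume.restrict (Ioo (-t) t)) :=
  hf.integrable one_le_two

/-- Continuity of the window transform `g(x) = ∫_{(−t,t)} K(x+y) f(y) dy` (dominated convergence). -/
theorem continuous_opWindow {K : ℝ → ℝ} (hKc : Continuous K) {t : ℝ} {f : ℝ → ℝ}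
    (hf : MemLp f 2 (volume.restrict (Ioo (-t) t))) :
    Continuous fun x : ℝ => ∫ y in Ioo (-t) t, K (x + y) * f y := by
  have hf1 := integrable_of_memLp_window hf
  refine continuous_iff_continuousAt.2 fun x₀ => ?_
  -- bound for |K| on the compact [x₀ - 1 - |t| - 1, x₀ + 1 + |t| + 1]
  obtain ⟨M, hM⟩ : ∃ M : ℝ, ∀ v ∈ Icc (x₀ - 1 - |t|) (x₀ + 1 + |t|), |K v| ≤ M := by
    have hc : IsCompact (Icc (x₀ - 1 - |t|) (x₀ + 1 + |t|)) := isCompact_Icc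
    obtain ⟨M, hM⟩ := hc.exists_bound_of_continuousOn hKc.continuousOn
    exact ⟨M, fun v hv => by simpa [Real.norm_eq_abs] using hM v hv⟩
  refine MeasureTheory.continuousAt_of_dominated (bound := fun y => M * |f y|) ?_ ?_ ?_ ?_
  · exact Eventually.of_forall fun x =>
      ((hKc.comp (continuous_const.add continuous_id)).aestronglyMeasurable).mul hf.1
  · have hball : ∀ᶠ x in 𝓝 x₀, |x - x₀| < 1 := by
      have := Metric.ball_mem_nhds x₀ (zero_lt_one)
      filter_upwards [this] with x hx
      rwa [Metric.mem_ball, Real.dist_eq] at hx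
    filter_upwards [hball] with x hx
    filter_upwards [ae_restrict_mem measurableSet_Ioo] with y hy
    rw [norm_mul, Real.norm_eq_abs, Real.norm_eq_abs]
    refine mul_le_mul_of_nonneg_right (hM _ ?_) (abs_nonneg _)
    have hy1 : -|t| ≤ y ∧ y ≤ |t| := by
      constructor
      · have := le_abs_self t; have := hy.1; linarith
      · have := le_abs_self t; have := hy.2; linarith
    have hx1 := abs_lt.1 hx
    constructor <;> linarith [hy1.1, hy1.2, hx1.1, hx1.2]
  · exact (hf1.abs).const_mul M
  · exact Eventually.of_forall fun y =>
      ((hKc.comp (continuous_id.add continuous_const)).mul continuous_const).continuousAt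

/-- RH-FREE (L4): FUBINI for the window transform against the character `e^{izx}`. -/
theorem laplace_opWindow_eq {K : ℝ → ℝ} (hKc : Continuous K) {z Θz : ℂ} (hz : 0 < z.im)
    (hInt : Integrable fun x : ℝ => (K x : ℂ) * Complex.exp (I * z * (x : ℂ)))
    (hLap : ∫ x : ℝ, (K x : ℂ) * Complex.exp (I * z * (x : ℂ)) = Θz)
    {t : ℝ} {f : ℝ → ℝ} (hf : MemLp f 2 (volume.restrict (Ioo (-t) t))) :
    Integrable (fun x : ℝ => ((∫ y in Ioo (-t) t, K (x + y) * f y : ℝ) : ℂ) * Complex.exp (I * z * (x : ℂ))) ∧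
      ∫ x : ℝ, ((∫ y in Ioo (-t) t, K (x + y) * f y : ℝ) : ℂ) * Complex.exp (I * z * (x : ℂ)) =
        Θz * ∫ y in Ioo (-t) t, (f y : ℂ) * Complex.exp (-(I * z * (y : ℂ))) := by
  set s : Set ℝ := Ioo (-t) t with hs_def
  have hs : MeasurableSet s := measurableSet_Ioo
  haveI : IsFiniteMeasure (volume.restrict s) := by rw [hs_def]; infer_instance
  have hf1 : Integrable f (volume.restrict s) := integrable_of_memLp_window hf
  set c : ℝ := z.im with hc_def
  -- the integrand on ℝ × s
  set F : ℝ × ℝ → ℂ := fun p => (K (p.1 + p.2) : ℂ) * (f p.2 : ℂ) * Complex.exp (I * z * (p.1 : ℂ)) with hF_def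
  have hFm : AEStronglyMeasurable F ((volume : Measure ℝ).prod (volume.restrict s)) := by
    have h1 : AEStronglyMeasurable (fun p : ℝ × ℝ => (K (p.1 + p.2) : ℂ))
        ((volume : Measure ℝ).prod (volume.restrict s)) :=
      (Complex.continuous_ofReal.comp (hKc.comp (continuous_fst.add continuous_snd))).aestronglyMeasurable
    have h2 : AEStronglyMeasurable (fun p : ℝ × ℝ => (f p.2 : ℂ))
        ((volume : Measure ℝ).prod (volume.restrict s)) :=
      (Complex.continuous_ofReal.comp_aestronglyMeasurable hf.1).comp_snd
    have h3 : AEStronglyMeasurable (fun p : ℝ × ℝ => Complex.exp (I * z * (p.1 : ℂ)))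
        ((volume : Measure ℝ).prod (volume.restrict s)) := by fun_prop
    exact (h1.mul h2).mul h3
  -- norm of the integrand
  have hFnorm : ∀ p : ℝ × ℝ, ‖F p‖ = |K (p.1 + p.2)| * |f p.2| * Real.exp (-(c * p.1)) := by
    intro p
    simp only [hF_def, norm_mul, Complex.norm_real, Real.norm_eq_abs,
      Summit.RiemannHypothesis.RiemannHypothesis.Theorems.SuzukiDoor.norm_cexp_I_mul_mul_ofReal, hc_def]
  -- the translate v ↦ |K v| e^{-cv} is integrable
  have hKn : Integrable fun v : ℝ => |K v| * Real.exp (-(c * v)) := by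
    have := hInt.norm
    refine this.congr (Eventually.of_forall fun v => ?_)
    simp only [norm_mul, Complex.norm_real, Real.norm_eq_abs,
      Summit.RiemannHypothesis.RiemannHypothesis.Theorems.SuzukiDoor.norm_cexp_I_mul_mul_ofReal, hc_def]
  set Mc : ℝ := ∫ v : ℝ, |K v| * Real.exp (-(c * v)) with hMc_def
  -- sections: for each y, x ↦ F (x, y) is integrable, with ∫ ‖F(x,y)‖ dx = |f y| e^{cy} Mc
  have hsec : ∀ y : ℝ, Integrable (fun x : ℝ => F (x, y)) ∧
      ∫ x : ℝ, ‖F (x, y)‖ = |f y| * Real.exp (c * y) * Mc := by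
    intro y
    have htr : Integrable fun x : ℝ => |K (x + y)| * Real.exp (-(c * (x + y))) :=
      hKn.comp_add_right y
    have hnormeq : ∀ x : ℝ, ‖F (x, y)‖ = |f y| * Real.exp (c * y) * (|K (x + y)| * Real.exp (-(c * (x + y)))) := by
      intro x
      rw [hFnorm]
      have : Real.exp (-(c * x)) = Real.exp (c * y) * Real.exp (-(c * (x + y))) := by
        rw [← Real.exp_add]; ring_nf
      rw [this]; ring
    have hi : Integrable (fun x : ℝ => F (x, y)) := by
      have hm : AEStronglyMeasurable (fun x : ℝ => F (x, y)) volume := by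
        simp only [hF_def]
        exact (((Complex.continuous_ofReal.comp (hKc.comp (continuous_id.add continuous_const))).mul
          continuous_const).mul (by fun_prop)).aestronglyMeasurable
      refine ⟨hm, ?_⟩
      have h2 : HasFiniteIntegral (fun x : ℝ => |f y| * Real.exp (c * y) * (|K (x + y)| * Real.exp (-(c * (x + y))))) volume :=
        (htr.const_mul _).hasFiniteIntegral
      refine h2.mono (Eventually.of_forall fun x => ?_)
      rw [hnormeq x, Real.norm_of_nonneg]
      positivity
    refine ⟨hi, ?_⟩
    simp_rw [hnormeq]
    rw [integral_const_mul, hMc_def]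
    congr 1
    exact integral_add_right_eq_self (μ := volume) (fun v : ℝ => |K v| * Real.exp (-(c * v))) y
  -- integrability on the product
  have hFi : Integrable F ((volume : Measure ℝ).prod (volume.restrict s)) := by
    rw [integrable_prod_iff' hFm]
    refine ⟨Eventually.of_forall fun y => (hsec y).1, ?_⟩
    simp_rw [(hsec _).2]
    have hb : Integrable (fun y : ℝ => |f y| * Real.exp (c * y) * Mc) (volume.restrict s) := by
      have hfe : Integrable (fun y : ℝ => |f y| * Real.exp (c * y)) (volume.restrict s) := by
        refine (hf1.abs.mul_const (Real.exp (c * |t|))).mono' (hf1.1.norm.mul (by fun_prop)) ?_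
        filter_upwards [ae_restrict_mem hs] with y hy
        rw [Real.norm_of_nonneg (by positivity)]
        refine mul_le_mul_of_nonneg_left (Real.exp_le_exp.2 ?_) (abs_nonneg _)
        have hy' : y ≤ |t| := by have := le_abs_self t; have := hy.2; linarith
        have hy'' : -|t| ≤ y := by have := le_abs_self t; have := hy.1; linarith
        by_cases hc0 : 0 ≤ c
        · nlinarith
        · push Not at hc0; nlinarith
      exact hfe.mul_const Mc
    exact hb
  -- Fubini
  have hFi' : Integrable (Function.uncurry fun x y : ℝ => F (x, y)) ((volume : Measure ℝ).prod (volume.restrict s)) := by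
    simpa [Function.uncurry_def] using hFi
  have hswap := integral_integral_swap hFi'
  -- identify the x-inner integral: ∫ y in s, F (x,y) = g x * e^{izx}
  have hinner_x : ∀ x : ℝ, ∫ y in s, F (x, y) =
      ((∫ y in s, K (x + y) * f y : ℝ) : ℂ) * Complex.exp (I * z * (x : ℂ)) := by
    intro x
    simp only [hF_def]
    rw [integral_mul_const]
    congr 1
    rw [← integral_complex_ofReal]
    refine integral_congr_ae (Eventually.of_forall fun y => ?_)
    push_cast; ring
  -- identify the y-inner integral: ∫ x, F (x,y) = f y e^{-izy} Θz
  have hinner_y : ∀ y : ℝ, ∫ x : ℝ, F (x, y) = (f y : ℂ) * Complex.exp (-(I * z * (y : ℂ))) * Θz := by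
    intro y
    have h1 : ∀ x : ℝ, F (x, y) = (f y : ℂ) * Complex.exp (-(I * z * (y : ℂ))) *
        ((K (x + y) : ℂ) * Complex.exp (I * z * ((x + y : ℝ) : ℂ))) := by
      intro x
      simp only [hF_def]
      have : Complex.exp (I * z * ((x + y : ℝ) : ℂ)) = Complex.exp (I * z * (x : ℂ)) * Complex.exp (I * z * (y : ℂ)) := by
        rw [← Complex.exp_add]; push_cast; ring_nf
      rw [this, Complex.exp_neg]
      have hne : Complex.exp (I * z * (y : ℂ)) ≠ 0 := Complex.exp_ne_zero _
      field_simp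
    simp_rw [h1]
    rw [integral_const_mul]
    congr 1
    rw [← hLap]
    exact integral_add_right_eq_self (μ := volume) (fun v : ℝ => (K v : ℂ) * Complex.exp (I * z * (v : ℂ))) y
  refine ⟨?_, ?_⟩
  · have := hFi.integral_prod_left
    refine this.congr (Eventually.of_forall fun x => ?_)
    exact hinner_x x
  · calc ∫ x : ℝ, ((∫ y in s, K (x + y) * f y : ℝ) : ℂ) * Complex.exp (I * z * (x : ℂ))
        = ∫ x : ℝ, ∫ y in s, F (x, y) := integral_congr_ae (Eventually.of_forall fun x => (hinner_x x).symm)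
      _ = ∫ y in s, ∫ x : ℝ, F (x, y) := hswap
      _ = ∫ y in s, (f y : ℂ) * Complex.exp (-(I * z * (y : ℂ))) * Θz :=
          integral_congr_ae (Eventually.of_forall fun y => hinner_y y)
      _ = Θz * ∫ y in s, (f y : ℂ) * Complex.exp (-(I * z * (y : ℂ))) := by
          rw [integral_mul_const]; ring

end Summit.RiemannHypothesis.RiemannHypothesis.Theorems.SuzukiWindowsDoorConverse
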